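import Literature.Computability.FineGrained.NSETHNonReducibility
import Literature.Computability.FineGrained.NSETHSparseTransfer
import HarnessLib

/-!
# NSETH and the non-reducibility of CNF-SAT to 3SUM: step 3 discharged

A sibling proof file of `NSETHNonReducibility.lean` (the decomposition of the named fact
`Literature.Computability.FineGrained.not_fgReducible_cnfSATWithSize_threeSUM_of_nseth`,
**fine-grained.S20**, after Carmosino et al., ITCS 2016, Thm. 2–3). It discharges step 3 of that
decomposition, the named fact

`kSATInExpTime_of_sparseKSATInExpTime_quantitative`: for `ρ ≥ 0`, if for every density `c` and
every `η > 0` the `k`-CNFs with at most `c · n` clauses are decidable by multi-stack Turing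
machines in time `2^{(ρ+η)n} · poly(L)` (`SparseKSATInExpTime k c (ρ + η)`), then `k`-SAT is
decidable in time `2^{(ρ+η)n} · poly(L)` for every `η > 0` (`KSATInExpTime k (ρ + η)`) —

the quantitative form of Corollary 2 of Impagliazzo–Paturi–Zane (JCSS 63 (2001), §2: `k`-SAT with
parameter `n` SERF-reduces to sparse `k`-SAT, by the sparsification lemma, Thm. 1 / Cor. 1), by
the theorem `kSATInExpTime_of_sparseKSATInExpTime_of_exponent` PROVED in
`NSETHSparseTransfer.lean` (sparsify with `ε = η/3` by the proved `sparsification_holds` of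
`SparsificationAlgorithm.lean`, decide each of the `≤ 2^{ε n}` produced density-`C` formulas with
the sparse machine of exponent `ρ + ε`, accept iff one of them is accepted;
`ε + (ρ + ε) + ε = ρ + η`), whose statement is literally the body of the named fact.

It then records the assembly theorems of `NSETHNonReducibility.lean` with step 3 supplied, so that
fine-grained.S20 now rests on the two remaining named facts only: the change of machine model
`sparseKSATInExpTime_of_cnfSATInThreeSumOracleRAMTime` (step 2) and
`kTAUTInNExpTime_of_kSATInExpTime` (step 4, `SatAlgorithms.lean`).

Nothing is restated here; no definition and no new named fact is introduced.

## References

* R. Impagliazzo, R. Paturi, F. Zane, *Which problems have strongly exponential complexity?*,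
  JCSS 63 (2001) 512–530, §2: Thm. 1, Cor. 1 (sparsification), Cor. 2 (SERF-reduction of `k`-SAT
  with parameter `n` to sparse `k`-SAT). [key `ImpagliazzoPaturiZaneJCSS2001`]
* D. Lokshtanov, D. Marx, S. Saurabh, *Lower bounds based on the Exponential Time Hypothesis*,
  Bull. EATCS 105 (2011), Lemma 2.8 (sparsification lemma) and the SERF-T reduction from
  `r`-CNF-Sat with parameter `n` to parameter `m` right after it (p. 9 of the held copy).
* M. L. Carmosino, J. Gao, R. Impagliazzo, I. Mihajlin, R. Paturi, S. Schneider, ITCS 2016, §5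
  Thm. 2–3. [key `CarmosinoEtAlITCS2016`]
-/

namespace Literature.Computability.FineGrained

open Cryptography Cryptography.WordRAM Complexity

/-! ### Step 3 discharged: Corollary 2 of Impagliazzo–Paturi–Zane, quantitative form, holds -/

/-- **Step 3 holds (discharge of the named fact).** The quantitative form of Corollary 2 of
Impagliazzo–Paturi–Zane on multi-stack Turing machines — for `ρ ≥ 0`, sparse `k`-SAT in time
`2^{(ρ+η)n} · poly(L)` for every density `c` and every `η > 0` gives `k`-SAT in time
`2^{(ρ+η)n} · poly(L)` for every `η > 0` — is the proved theorem
`kSATInExpTime_of_sparseKSATInExpTime_of_exponent` of `NSETHSparseTransfer.lean`: sparsify with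
`ε = η/3` by the proved sparsification lemma `sparsification_holds` (Thm. 1 / Cor. 1 of the source:
at most `2^{ε n}` formulas on the same `n` variables with `≤ C n` clauses each, in time
`2^{ε n} poly(L)`), decide each produced formula with the density-`C` machine of exponent `ρ + ε`,
accept iff one of them is accepted; `ε + (ρ + ε) + ε = ρ + η` (the SERF-reduction of `k`-SAT with
parameter `n` to sparse `k`-SAT, Cor. 2, composed with the sparse decider).
[cite: ImpagliazzoPaturiZaneJCSS2001, Cor. 2 (with Thm. 1 / Cor. 1)] -/
theorem kSATInExpTime_of_sparseKSATInExpTime_quantitative_holds :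
    kSATInExpTime_of_sparseKSATInExpTime_quantitative :=
  fun _k _ρ hρ h η hη => kSATInExpTime_of_sparseKSATInExpTime_of_exponent hρ h η hη

/-! ### The assembly with step 3 supplied -/

/-- **Steps 2–4 with step 3 discharged.** From the change of machine model
(`sparseKSATInExpTime_of_cnfSATInThreeSumOracleRAMTime`) and `k`-TAUT from `k`-SAT
(`kTAUTInNExpTime_of_kSATInExpTime`) alone: a 3SUM-oracle program of exponent `0 ≤ ρ < 1` for
`CNFSATWithSize c`, `c ≥ 2`, refutes NSETH (`not_nseth_of_cnfSATInThreeSumOracleRAMTime` with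
`kSATInExpTime_of_sparseKSATInExpTime_quantitative_holds`).
[cite: CarmosinoEtAlITCS2016, §5 Thm. 2 (proof)] -/
theorem not_nseth_of_cnfSATInThreeSumOracleRAMTime'
    (h3 : sparseKSATInExpTime_of_cnfSATInThreeSumOracleRAMTime)
    (h5 : kTAUTInNExpTime_of_kSATInExpTime)
    {c : ℕ} (hc : 2 ≤ c) {ρ : ℝ} (hρ0 : 0 ≤ ρ) (hρ1 : ρ < 1)
    (hram : CNFSATInThreeSumOracleRAMTime c ρ) : ¬ NSETH :=
  not_nseth_of_cnfSATInThreeSumOracleRAMTime h3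
    kSATInExpTime_of_sparseKSATInExpTime_quantitative_holds h5 hc hρ0 hρ1 hram

/-- **Assembly with step 3 discharged.** The change of machine model
(`sparseKSATInExpTime_of_cnfSATInThreeSumOracleRAMTime`) and `k`-TAUT from `k`-SAT
(`kTAUTInNExpTime_of_kSATInExpTime`) imply fine-grained.S20
(`not_fgReducible_cnfSATWithSize_threeSUM_of_nseth`) verbatim, step 3 being supplied by
`kSATInExpTime_of_sparseKSATInExpTime_quantitative_holds`.
[cite: CarmosinoEtAlITCS2016, §5 Thm. 2–3] -/
theorem not_fgReducible_cnfSATWithSize_threeSUM_of_nseth_of'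
    (h3 : sparseKSATInExpTime_of_cnfSATInThreeSumOracleRAMTime)
    (h5 : kTAUTInNExpTime_of_kSATInExpTime) :
    not_fgReducible_cnfSATWithSize_threeSUM_of_nseth :=
  not_fgReducible_cnfSATWithSize_threeSUM_of_nseth_of h3
    kSATInExpTime_of_sparseKSATInExpTime_quantitative_holds h5

/-- The same for an arbitrary 3SUM budget `b`, step 3 discharged
(`not_fgReducible_cnfSATWithSize_threeSUM_budget_of` with
`kSATInExpTime_of_sparseKSATInExpTime_quantitative_holds`).
[cite: CarmosinoEtAlITCS2016, §5 Thm. 2–3] -/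
theorem not_fgReducible_cnfSATWithSize_threeSUM_budget_of'
    (h3 : sparseKSATInExpTime_of_cnfSATInThreeSumOracleRAMTime)
    (h5 : kTAUTInNExpTime_of_kSATInExpTime)
    (hN : NSETH) {c : ℕ} (hc : 2 ≤ c) (b : ℕ → ℝ) :
    ¬ FGReducible (CNFSATWithSize c) (fun n => (2 : ℝ) ^ (n : ℝ)) threeSUM b :=
  not_fgReducible_cnfSATWithSize_threeSUM_budget_of h3
    kSATInExpTime_of_sparseKSATInExpTime_quantitative_holds h5 hN hc b

end Literature.Computability.FineGrained
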